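import Summits.QuantumFields.BalabanUV.Beta.TubeMaximumModulus

/-!
# Beta / TubeHolAlgebra — the algebra under which `TubeHol` (periodic poly-holomorphy on a closed tube) is closed, and the
# (Z2) binder of the ONE-LOOP FORM from a bound on the VERTEX TORI only (β sub-cell, BINDER-OWNERS row CAP-k, lineage
# `b2b-balaban-beta-an5`, gen 21; node BETA-an5-g21-FACE-MAXMOD part 2, journal l.4988)

Companion to `Beta.TubeMaximumModulus` (SAME namespace `…Beta.TubeMaximumModulus`, so that dot-notation `h.add`, `hA.inv` …
resolves; the structure `TubeHol G w`, the distinguished-boundary maximum principle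
`TubeHol.norm_le_of_vertexTori`, the binder forms `TubeHol.stripRegularC_of_vertexTori`).  This module discharges the
STRUCTURAL hypothesis `TubeHol` for the families the engines' integrands are built from, exactly parallel to cap3-g8's
`Beta.PolyRegularAlgebra` §2–§3 for `PolyHol`:

* §1 scalar algebra: constants, lattice characters `q ↦ e^{i x·q}` (`tubeHol_character`), `add` ∕ `neg` ∕ `sub` ∕ `mul` ∕
  `const_mul`, finite `sum` ∕ `prod`, `pow`, `inv` ∕ `div` where the denominator has NO ZERO ON THE POLYSTRIP PERIOD CELL
  (periodic reduction `TubeHol.ne_zero_of_polyStrip` carries the non-vanishing to the whole tube).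
* §2 matrix families `MatTubeHol A w` (entrywise; `MatTubeHol.matPolyHol`): constants, character sums
  `q ↦ Σ_{x ∈ S} e^{i x·q} • K x` (`matTubeHol_characterSum` — every engine stencil family), `add` ∕ `sub` ∕ `smul` ∕ `mul`,
  sums, `det`, `updateRow`, `adjugate`, the INVERSE under (Z1) on the period cell (`MatTubeHol.inv`), `trace`; the tadpole
  and bubble traces, the one-loop form `tubeHol_oneLoopForm`; and the binder-shaped ENDs
  `stripRegularC_trace_resolvent_ofVertexTori`, **`stripRegularC_oneLoopForm_ofVertexTori`**: STRUCTURE (`MatTubeHol` ×5)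
  + (Z1) for both resolvent families on the period cell + a certified bound `M` of `t₁ − t₂` ON THE `2^{d+1}` VERTEX TORI
  ONLY ⟹ `StripRegularC (t₁ − t₂) κ M` — the (Z2) binder of `PolyRegularAlgebra.stripRegularC_oneLoopForm` ∕
  `CapRowsLattice.rowsOfOneLoopFormCode16E` in the currency the engines certify (CAP-KERNEL §4.10 (i), §4.15 (b)).

HONEST FRAMING.  Kernel glue ([folklore] over Mathlib and the tree): no number of the β-function, no binder INSTANCE for the
cell's actual integrand (its stencil tables live in the engines), no certificate; (Z1) stays a certificate on the period
cell.  Discharging `BetaPertH` would make Bałaban's ultraviolet stability unconditional — NOT the continuum limit, NOT the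
Clay problem.  0 `sorry`, 0 cite tags.
-/

namespace Summit.QuantumFields.BalabanUV.Beta.TubeMaximumModulus

open Complex Set
open Literature.MathematicalPhysics.QuantumFieldTheory.Balaban1983to89
open B4Strip (ofRealVec Strip)
open B4ContourShift
open Beta.AliasingTailL1
open Summit.QuantumFields.BalabanUV.Beta.PolyRegularAlgebra
open scoped Real

noncomputable section

variable {d : ℕ}
variable {G : (Fin (d + 1) → ℂ) → ℂ} {w : Fin (d + 1) → ℝ}

/-! ## §1 Scalar algebra -/

section Scalar

variable {G₁ G₂ F : (Fin (d + 1) → ℂ) → ℂ}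

/-- constants. [folklore] -/
theorem tubeHol_const (a : ℂ) (w : Fin (d + 1) → ℝ) : TubeHol (fun _ : Fin (d + 1) → ℂ => a) w :=
  ⟨fun _ _ => rfl, continuousOn_const, fun _ _ _ => differentiableOn_const a⟩

/-- sums. [folklore] -/
theorem TubeHol.add (h₁ : TubeHol G₁ w) (h₂ : TubeHol G₂ w) : TubeHol (fun p => G₁ p + G₂ p) w := by
  refine ⟨?_, h₁.cont.add h₂.cont, fun i q hq => (h₁.diff i q hq).add (h₂.diff i q hq)⟩
  intro i p
  show _ = _
  rw [h₁.periodic i p, h₂.periodic i p]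

/-- products. [folklore] -/
theorem TubeHol.mul (h₁ : TubeHol G₁ w) (h₂ : TubeHol G₂ w) : TubeHol (fun p => G₁ p * G₂ p) w := by
  refine ⟨?_, h₁.cont.mul h₂.cont, fun i q hq => (h₁.diff i q hq).mul (h₂.diff i q hq)⟩
  intro i p
  show _ = _
  rw [h₁.periodic i p, h₂.periodic i p]

/-- negation. [folklore] -/
theorem TubeHol.neg (h : TubeHol G w) : TubeHol (fun p => -G p) w := by
  refine ⟨?_, h.cont.neg, fun i q hq => (h.diff i q hq).neg⟩
  intro i p
  show _ = _
  rw [h.periodic i p]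

/-- differences. [folklore] -/
theorem TubeHol.sub (h₁ : TubeHol G₁ w) (h₂ : TubeHol G₂ w) : TubeHol (fun p => G₁ p - G₂ p) w := by
  refine ⟨?_, h₁.cont.sub h₂.cont, fun i q hq => (h₁.diff i q hq).sub (h₂.diff i q hq)⟩
  intro i p
  show _ = _
  rw [h₁.periodic i p, h₂.periodic i p]

/-- constant multiples. [folklore] -/
theorem TubeHol.const_mul (h : TubeHol G w) (a : ℂ) : TubeHol (fun p => a * G p) w :=
  (tubeHol_const a w).mul h

/-- FINITE SUMS. [folklore] -/
theorem TubeHol.sum {ι : Type*} (s : Finset ι) {H : ι → (Fin (d + 1) → ℂ) → ℂ}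
    (h : ∀ k ∈ s, TubeHol (H k) w) : TubeHol (fun p => ∑ k ∈ s, H k p) w := by
  classical
  revert h
  refine Finset.induction_on s ?_ ?_
  · intro _
    simp only [Finset.sum_empty]
    exact tubeHol_const 0 w
  · intro a s ha ih h
    have e : (fun p => ∑ k ∈ insert a s, H k p) = fun p => H a p + ∑ k ∈ s, H k p := by
      funext p; rw [Finset.sum_insert ha]
    rw [e]
    exact (h a (Finset.mem_insert_self a s)).add (ih fun k hk => h k (Finset.mem_insert_of_mem hk))

/-- FINITE PRODUCTS. [folklore] -/
theorem TubeHol.prod {ι : Type*} (s : Finset ι) {H : ι → (Fin (d + 1) → ℂ) → ℂ}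
    (h : ∀ k ∈ s, TubeHol (H k) w) : TubeHol (fun p => ∏ k ∈ s, H k p) w := by
  classical
  revert h
  refine Finset.induction_on s ?_ ?_
  · intro _
    simp only [Finset.prod_empty]
    exact tubeHol_const 1 w
  · intro a s ha ih h
    have e : (fun p => ∏ k ∈ insert a s, H k p) = fun p => H a p * ∏ k ∈ s, H k p := by
      funext p; rw [Finset.prod_insert ha]
    rw [e]
    exact (h a (Finset.mem_insert_self a s)).mul (ih fun k hk => h k (Finset.mem_insert_of_mem hk))

/-- powers. [folklore] -/
theorem TubeHol.pow (h : TubeHol G w) (n : ℕ) : TubeHol (fun p => G p ^ n) w := by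
  induction n with
  | zero =>
    simp only [pow_zero]
    exact tubeHol_const 1 w
  | succ n ih =>
    have e : (fun p => G p ^ (n + 1)) = fun p => G p ^ n * G p := by funext p; rw [pow_succ]
    rw [e]
    exact ih.mul h

/-- INVERSE OF A tube-holomorphic function WITH NO ZERO ON THE POLYSTRIP PERIOD CELL (periodicity carries the
non-vanishing to the whole tube). [folklore] -/
theorem TubeHol.inv (h : TubeHol F w) (hne : ∀ p ∈ PolyStrip w, F p ≠ 0) : TubeHol (fun p => (F p)⁻¹) w := by
  have hne' := h.ne_zero_of_polyStrip hne
  refine ⟨?_, h.cont.inv₀ hne', ?_⟩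
  · intro i p
    show _ = _
    rw [h.periodic i p]
  · intro i q hq
    refine (h.diff i q hq).inv ?_
    intro z hz
    exact hne' _ (insertNth_mem_tube i hq (abs_le.mpr ⟨hz.1.le, hz.2.le⟩))

/-- quotients. [folklore] -/
theorem TubeHol.div (h₁ : TubeHol G w) (h₂ : TubeHol F w) (hne : ∀ p ∈ PolyStrip w, F p ≠ 0) :
    TubeHol (fun p => G p / F p) w := by
  have e : (fun p => G p / F p) = fun p => G p * (F p)⁻¹ := by funext p; rw [div_eq_mul_inv]
  rw [e]
  exact h₁.mul (h₂.inv hne)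

/-- LATTICE CHARACTERS `q ↦ e^{i x·q}` ARE TUBE-HOLOMORPHIC on every tube (entire, `2π`-periodic in each coordinate). [folklore] -/
theorem tubeHol_character (x : Fin (d + 1) → ℤ) (w : Fin (d + 1) → ℝ) : TubeHol (character x) w := by
  refine ⟨?_, ?_, ?_⟩
  · intro i p
    have e1 : Function.update p i (p i + 2 * π) = i.insertNth (p i + 2 * π) (i.removeNth p) :=
      (Fin.insertNth_removeNth i _ p).symm
    have e2 : character x p = character x (i.insertNth (p i) (i.removeNth p)) := by
      rw [Fin.insertNth_self_removeNth]
    rw [e1, e2, character_insertNth, character_insertNth, Complex.exp_eq_exp_iff_exists_int]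
    exact ⟨x i, by ring⟩
  · apply Continuous.continuousOn
    unfold character
    fun_prop
  · intro i q _
    have e : (fun z => character x (i.insertNth z q)) =
        fun z => cexp (I * ((x i : ℂ) * z + ∑ k, (x (i.succAbove k) : ℂ) * q k)) := by
      funext z; exact character_insertNth x i z q
    rw [e]
    apply Differentiable.differentiableOn
    fun_prop

end Scalar

/-! ## §2 Matrix families, the one-loop form, the binder END over the vertex tori -/

section Matrix

variable {n : Type*}
variable {A A' B C D : (Fin (d + 1) → ℂ) → Matrix n n ℂ}

/-- a MATRIX FAMILY is tube-holomorphic when every entry is. [folklore] -/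
def MatTubeHol (A : (Fin (d + 1) → ℂ) → Matrix n n ℂ) (w : Fin (d + 1) → ℝ) : Prop :=
  ∀ i j, TubeHol (fun p => A p i j) w

/-- entrywise, `MatTubeHol` implies cap3-g8's `MatPolyHol`. [folklore] -/
theorem MatTubeHol.matPolyHol (hA : MatTubeHol A w) : MatPolyHol A w := fun i j => (hA i j).polyHol

/-- constant families. [folklore] -/
theorem matTubeHol_const (K : Matrix n n ℂ) (w : Fin (d + 1) → ℝ) :
    MatTubeHol (fun _ : Fin (d + 1) → ℂ => K) w :=
  fun i j => tubeHol_const (K i j) w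

/-- sums. [folklore] -/
theorem MatTubeHol.add (hA : MatTubeHol A w) (hB : MatTubeHol B w) : MatTubeHol (fun p => A p + B p) w :=
  fun i j => by
    simp only [Matrix.add_apply]
    exact (hA i j).add (hB i j)

/-- differences. [folklore] -/
theorem MatTubeHol.sub (hA : MatTubeHol A w) (hB : MatTubeHol B w) : MatTubeHol (fun p => A p - B p) w :=
  fun i j => by
    simp only [Matrix.sub_apply]
    exact (hA i j).sub (hB i j)

/-- scalar multiples by a tube-holomorphic function. [folklore] -/
theorem MatTubeHol.smul (hA : MatTubeHol A w) {g : (Fin (d + 1) → ℂ) → ℂ} (hg : TubeHol g w) :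
    MatTubeHol (fun p => g p • A p) w :=
  fun i j => by
    simp only [Matrix.smul_apply, smul_eq_mul]
    exact hg.mul (hA i j)

/-- MATRIX PRODUCTS. [folklore] -/
theorem MatTubeHol.mul [Fintype n] (hA : MatTubeHol A w) (hB : MatTubeHol B w) :
    MatTubeHol (fun p => A p * B p) w :=
  fun i j => by
    simp only [Matrix.mul_apply]
    exact TubeHol.sum _ fun k _ => (hA i k).mul (hB k j)

/-- finite sums of matrix families. [folklore] -/
theorem MatTubeHol.sum {ι : Type*} (s : Finset ι) {H : ι → (Fin (d + 1) → ℂ) → Matrix n n ℂ}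
    (h : ∀ k ∈ s, MatTubeHol (H k) w) : MatTubeHol (fun p => ∑ k ∈ s, H k p) w :=
  fun i j => by
    simp only [Matrix.sum_apply]
    exact TubeHol.sum s fun k hk => h k hk i j

/-- CHARACTER SUMS `q ↦ Σ_{x ∈ S} e^{i x·q} • K x` with constant matrix coefficients — the shape of every stencil family
of the engines — are tube-holomorphic on every tube. [folklore] -/
theorem matTubeHol_characterSum (S : Finset (Fin (d + 1) → ℤ)) (K : (Fin (d + 1) → ℤ) → Matrix n n ℂ)
    (w : Fin (d + 1) → ℝ) : MatTubeHol (fun p => ∑ x ∈ S, character x p • K x) w :=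
  MatTubeHol.sum S fun x _ => (matTubeHol_const (K x) w).smul (tubeHol_character x w)

/-- THE DETERMINANT of a tube-holomorphic matrix family is tube-holomorphic. [folklore] -/
theorem MatTubeHol.det [Fintype n] [DecidableEq n] (hA : MatTubeHol A w) : TubeHol (fun p => (A p).det) w := by
  have e : (fun p => (A p).det) =
      fun p => ∑ σ : Equiv.Perm n, ((Equiv.Perm.sign σ : ℤ) : ℂ) * ∏ i, A p (σ i) i := by
    funext p
    rw [Matrix.det_apply]
    exact Finset.sum_congr rfl fun σ _ => by rw [Units.smul_def, zsmul_eq_mul]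
  rw [e]
  exact TubeHol.sum _ fun σ _ => (TubeHol.prod _ fun i _ => hA (σ i) i).const_mul _

/-- replacing a row by a constant row keeps tube-holomorphy. [folklore] -/
theorem MatTubeHol.updateRow [DecidableEq n] (hA : MatTubeHol A w) (j : n) (v : n → ℂ) :
    MatTubeHol (fun p => (A p).updateRow j v) w :=
  fun i k => by
    by_cases hij : i = j
    · subst hij
      simp only [Matrix.updateRow_self]
      exact tubeHol_const _ _
    · simp only [Matrix.updateRow_ne hij]
      exact hA i k

/-- THE ADJUGATE of a tube-holomorphic matrix family is tube-holomorphic. [folklore] -/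
theorem MatTubeHol.adjugate [Fintype n] [DecidableEq n] (hA : MatTubeHol A w) :
    MatTubeHol (fun p => (A p).adjugate) w :=
  fun i j => by
    simp only [Matrix.adjugate_apply]
    exact (hA.updateRow j (Pi.single i 1)).det

/-- THE INVERSE of a tube-holomorphic matrix family whose DETERMINANT HAS NO ZERO ON THE POLYSTRIP PERIOD CELL (the cell's
(Z1), certified outside the kernel) is tube-holomorphic — `A⁻¹ = (det A)⁻¹ • adj A`, the determinant's non-vanishing carried
to the tube by periodicity. [folklore] -/
theorem MatTubeHol.inv [Fintype n] [DecidableEq n] (hA : MatTubeHol A w) (hdet : ∀ p ∈ PolyStrip w, (A p).det ≠ 0) :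
    MatTubeHol (fun p => (A p)⁻¹) w :=
  fun i j => by
    have e : (fun p => (A p)⁻¹ i j) = fun p => ((A p).det)⁻¹ * (A p).adjugate i j := by
      funext p; rw [Matrix.inv_def, Matrix.smul_apply, smul_eq_mul, Ring.inverse_eq_inv']
    rw [e]
    exact (hA.det.inv hdet).mul (hA.adjugate i j)

/-- THE TRACE of a tube-holomorphic matrix family is tube-holomorphic. [folklore] -/
theorem MatTubeHol.trace [Fintype n] (hA : MatTubeHol A w) : TubeHol (fun p => (A p).trace) w := by
  have e : (fun p => (A p).trace) = fun p => ∑ i, A p i i := by funext p; rfl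
  rw [e]
  exact TubeHol.sum _ fun i _ => hA i i

/-- THE TADPOLE FORM `q ↦ tr((A q)⁻¹ B q)` is tube-holomorphic under (Z1) for `A`. [folklore] -/
theorem tubeHol_trace_resolvent [Fintype n] [DecidableEq n] (hA : MatTubeHol A w) (hB : MatTubeHol B w)
    (hdet : ∀ p ∈ PolyStrip w, (A p).det ≠ 0) : TubeHol (fun p => ((A p)⁻¹ * B p).trace) w :=
  ((hA.inv hdet).mul hB).trace

/-- THE BUBBLE FORM `q ↦ tr((A q)⁻¹ C q (A′ q)⁻¹ D q)` is tube-holomorphic under (Z1) for `A` and `A′`. [folklore] -/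
theorem tubeHol_trace_bubble [Fintype n] [DecidableEq n] (hA : MatTubeHol A w) (hA' : MatTubeHol A' w)
    (hC : MatTubeHol C w) (hD : MatTubeHol D w) (hdet : ∀ p ∈ PolyStrip w, (A p).det ≠ 0)
    (hdet' : ∀ p ∈ PolyStrip w, (A' p).det ≠ 0) :
    TubeHol (fun p => ((A p)⁻¹ * C p * (A' p)⁻¹ * D p).trace) w :=
  ((((hA.inv hdet).mul hC).mul (hA'.inv hdet')).mul hD).trace

/-- THE ONE-LOOP FORM `t₁ − t₂ = tr(A⁻¹ B) − tr(A⁻¹ C A′⁻¹ D)` is tube-holomorphic under (Z1) for `A`, `A′`. [folklore] -/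
theorem tubeHol_oneLoopForm [Fintype n] [DecidableEq n] (hA : MatTubeHol A w) (hA' : MatTubeHol A' w)
    (hB : MatTubeHol B w) (hC : MatTubeHol C w) (hD : MatTubeHol D w) (hdet : ∀ p ∈ PolyStrip w, (A p).det ≠ 0)
    (hdet' : ∀ p ∈ PolyStrip w, (A' p).det ≠ 0) :
    TubeHol (fun p => ((A p)⁻¹ * B p).trace - ((A p)⁻¹ * C p * (A' p)⁻¹ * D p).trace) w :=
  (tubeHol_trace_resolvent hA hB hdet).sub (tubeHol_trace_bubble hA hA' hC hD hdet hdet')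

/-- **BINDER-SHAPED END OVER THE VERTEX TORI, tadpole form**: structure + (Z1) on the period cell + a certified bound `M` of
`tr((A q)⁻¹ B q)` on the `2^{d+1}` VERTEX TORI `|Im q_μ| = κ ∀μ` ⟹ `StripRegularC (q ↦ tr((A q)⁻¹ B q)) κ M`. [folklore] -/
theorem stripRegularC_trace_resolvent_ofVertexTori [Fintype n] [DecidableEq n] {κ M : ℝ}
    (hA : MatTubeHol A (fun _ => κ)) (hB : MatTubeHol B (fun _ => κ))
    (hdet : ∀ p ∈ Strip (d + 1) κ, (A p).det ≠ 0)
    (hM : ∀ p ∈ VertexTori (fun _ : Fin (d + 1) => κ), ‖((A p)⁻¹ * B p).trace‖ ≤ M) :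
    StripRegularC (fun p => ((A p)⁻¹ * B p).trace) κ M :=
  (tubeHol_trace_resolvent hA hB hdet).stripRegularC_of_vertexTori hM

/-- **BINDER-SHAPED END OVER THE VERTEX TORI, the ONE-LOOP FORM** (the cell's integrand with `A = k₀`, `A′ = k₀(· − p)`):
STRUCTURE (`MatTubeHol` ×5 — automatic for character sums, `matTubeHol_characterSum`) + (Z1) for both resolvent families
on the polystrip PERIOD CELL + a certified bound `M` of `t₁ − t₂` ON THE VERTEX TORI ONLY (real dimension `d + 1`; for the
cell the 16 shifted real 4-tori `Im q = κ·s`) ⟹ `StripRegularC (t₁ − t₂) κ M` — the (Z2) binder of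
`PolyRegularAlgebra.stripRegularC_oneLoopForm` ∕ `CapRowsLattice.rowsOfOneLoopFormCode16E` in the currency the engines
certify (CAP-KERNEL §4.10 (i), §4.15 (b)). [folklore] -/
theorem stripRegularC_oneLoopForm_ofVertexTori [Fintype n] [DecidableEq n] {κ M : ℝ}
    (hA : MatTubeHol A (fun _ => κ)) (hA' : MatTubeHol A' (fun _ => κ)) (hBst : MatTubeHol B (fun _ => κ))
    (hBs : MatTubeHol C (fun _ => κ)) (hBt : MatTubeHol D (fun _ => κ))
    (hdet : ∀ p ∈ Strip (d + 1) κ, (A p).det ≠ 0) (hdet' : ∀ p ∈ Strip (d + 1) κ, (A' p).det ≠ 0)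
    (hM : ∀ p ∈ VertexTori (fun _ : Fin (d + 1) => κ),
      ‖((A p)⁻¹ * B p).trace - ((A p)⁻¹ * C p * (A' p)⁻¹ * D p).trace‖ ≤ M) :
    StripRegularC (fun p => ((A p)⁻¹ * B p).trace - ((A p)⁻¹ * C p * (A' p)⁻¹ * D p).trace) κ M :=
  (tubeHol_oneLoopForm hA hA' hBst hBs hBt hdet hdet').stripRegularC_of_vertexTori hM

end Matrix

/-! ## §3 (v1.1, APPEND-ONLY) SHIFTED character sums — the family `k₀(· − p)` of the bubble term

The second resolvent family of the one-loop form is the SHIFTED stencil family `A′ q = k₀(q − p) = Σ_R e^{i(q−p)·R} K[R]`, for the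
external momentum `p` — REAL on the β-row, COMPLEX (|p_i| ≤ r) inside LEMMA JC's Cauchy discs.  Since `e^{i x·(q−p)} = e^{−i x·p}·e^{i x·q}`,
it is again a character sum in `q` with the phases moved into the coefficients, hence `MatTubeHol` on EVERY tube, for EVERY complex
`p` — the STRUCTURE binder `hA'` of the rows is discharged by `matTubeHol_characterSum_sub` exactly as `hA` is by
`matTubeHol_characterSum`. -/

section Shift

variable {n : Type*}

/-- `e^{i x·(q − p)} = e^{i x·(−p)} · e^{i x·q}`. [folklore] -/
theorem character_sub (x : Fin (d + 1) → ℤ) (q p : Fin (d + 1) → ℂ) :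
    character x (q - p) = character x (-p) * character x q := by
  unfold character
  rw [← Complex.exp_add]
  congr 1
  rw [← mul_add, ← Finset.sum_add_distrib]
  congr 1
  exact Finset.sum_congr rfl fun μ _ => by simp only [Pi.sub_apply, Pi.neg_apply]; ring

/-- the shifted character `q ↦ e^{i x·(q − p)}` is tube-holomorphic on every tube, for every complex shift `p`. [folklore] -/
theorem tubeHol_character_sub (x : Fin (d + 1) → ℤ) (w : Fin (d + 1) → ℝ) (p : Fin (d + 1) → ℂ) :
    TubeHol (fun q => character x (q - p)) w := by
  have e : (fun q => character x (q - p)) = fun q => character x (-p) * character x q := by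
    funext q; exact character_sub x q p
  rw [e]
  exact (tubeHol_character x w).const_mul _

/-- **SHIFTED CHARACTER SUMS ARE TUBE-HOLOMORPHIC**: `q ↦ Σ_{x ∈ S} e^{i x·(q − p)} • K x` (the engines' `k₀(q − p)`, `k_s(q − p)`, …)
is `MatTubeHol` on every tube, for every complex `p`. [folklore] -/
theorem matTubeHol_characterSum_sub (S : Finset (Fin (d + 1) → ℤ)) (K : (Fin (d + 1) → ℤ) → Matrix n n ℂ)
    (w : Fin (d + 1) → ℝ) (p : Fin (d + 1) → ℂ) :
    MatTubeHol (fun q => ∑ x ∈ S, character x (q - p) • K x) w :=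
  MatTubeHol.sum S fun x _ => (matTubeHol_const (K x) w).smul (tubeHol_character_sub x w p)

/-- the same for a scalar character sum `q ↦ Σ_{x ∈ S} c x · e^{i x·(q − p)}`. [folklore] -/
theorem tubeHol_characterSum_sub (S : Finset (Fin (d + 1) → ℤ)) (c : (Fin (d + 1) → ℤ) → ℂ)
    (w : Fin (d + 1) → ℝ) (p : Fin (d + 1) → ℂ) :
    TubeHol (fun q => ∑ x ∈ S, c x * character x (q - p)) w :=
  TubeHol.sum S fun x _ => (tubeHol_character_sub x w p).const_mul _

end Shift

end

end Summit.QuantumFields.BalabanUV.Beta.TubeMaximumModulus
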